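import Summits.HodgeConjecture.HodgeConjecture.Theorems.Ring2WeilCoverageWeilGramCMPoint
import Summits.HodgeConjecture.HodgeConjecture.Theorems.Ring2WeilCoverageCyclotomicUnconditional
import Summits.HodgeConjecture.HodgeConjecture.Theorems.Ring2WeilCoverageRealUnitNormHalfSystems
import Summits.HodgeConjecture.HodgeConjecture.Theorems.Ring2WeilCoverageNormTable
import HarnessLib

/-!
# Weil-type family coverage — THE COMPONENTS OF THE WEIL-TYPE `ℤ[ζ₈₄]`-TWELVEFOLDS, I: level lemmas (`Φ₈₄(ζ) = 0`
# written out, the real frame `θ^i`, the skew generators `i = ζ²¹`, `s₃ = 1 + 2ζ²⁸`, `s₇ = 1 + 2(ζ¹² + ζ²⁴ + ζ⁴⁸)`, `s₂₁ = ζ²¹(1 + 2ζ²⁸)(1 + 2(ζ¹² + ζ²⁴ + ζ⁴⁸))`,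
# the census parameter `ξ = ζ¹¹/Φ₈₄′(ζ)`, `θ¹²` and the trace recurrence)

research route conditional on HC_CM; not a corollary; Q11.4-sentence-2 already refuted in dim ≥ 3.

Ring 2, WEIL-TYPE FAMILY-COVERAGE CENSUS (`HOME/WEIL-FAMILY-COVERAGE.md` `## b01`, blocks b01.36 (D) (the YES rows at `84`),
b01.47–b01.49 (the component rule at the other `h = 1` levels); owner ring2-b01), part 177 of the `Ring2WeilCoverage*`
series (`K = ℚ(ζ₈₄)`, `g = 12`, `n = 6`, real frame `xᵢ = θ^i`, `θ = ζ + ζ⁻¹`, `i < 12`).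
At the level `M = 84` (`g = 12`, `h(ℚ(ζ₈₄)) = 1`) EVERY census row `(84, K_d)` is a YES row (an `ι`-compatible
PRINCIPAL polarisation exists on every `K_d`-balanced `ℂ^Φ/Φ(ℤ[ζ₈₄])`, b01.36 / parts 14–22); this series computes, for each
`K_d ⊂ ℚ(ζ₈₄)`, van Geemen's Gram determinant of the principal type in the real frame `θ^i` and places these CM points on
their component: the SPLIT row `W12.d.1` — completing the census's component column at every `h = 1` level (b01.47–b01.49
did `15, 16, 20, 24 / 21, 28, 36 / 33, 44 / 35, 45`).
For a skew `ζ′` and a skew `s` with `s² = −d`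
part 82 (`Ring2WeilCoverageWeilGramCMPoint`) shows that the Gram matrix `Ψ = a + b√−d` of van Geemen's hermitian form
`H = E(x, sy) + √−d E(x, y)`, `E = E_ζ′ = Tr_{K/ℚ}(ζ′xȳ)`, in a real frame is the rational matrix `a = (−Tr(ζ′s xᵢxⱼ))`,
`b = 0`, with `det a = (−2)^g N_{K⁺/ℚ}(ζ′s) disc(ω)`; for `n = 6` (EVEN) the split class is `Nm` itself and a `Φ`-positive
`ζ′` on a Weil-type (`(6,6)`) CM type has `(−1)⁶ det a = det a > 0` (part 92).

This file holds only the level lemmas shared by the Gram files `Ring2WeilCoverageWeilGramLevel84*` (parts 178+):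
`Φ₈₄(ζ) = 0` written out, `θ` and the frame `θ^i` are real, `ξ` is skew, the skew generators `s` (`s² = −d`, `s^ρ = −s`)
of the 4 imaginary quadratic subfields `K_d`, `d ∈ {1, 3, 7, 21}`, `θ¹²` in the frame (the minimal polynomial of
`θ`) and the trace recurrences `Tr(yθ^m)`, `12 ≤ m ≤ 22`.

HONEST FRAMING as parts 82–154: kernel statements about elements of `ℚ(ζ₈₄)`; nothing about Hodge classes, `W_K`,
general members or HC; `HC_CM` is used nowhere.  No `def`, no named fact, no `sorry`.  Certificates produced by
`work/py/geng.py` + `allyes.py` (exact arithmetic in `ℚ[x]/Φ_84`, stdlib) and re-verified here by `linear_combination`.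

References: [cite: vanGeemen1994HodgeAV, Lemma 5.2 (2)–(4)]; [cite: Shimura1998, §14.3 Prop. 4–5, pp. 103–104]; [folklore].
-/

noncomputable section

open Polynomial NumberField Module
open scoped nonZeroDivisors

namespace Summit.HodgeConjecture.Ring2WeilCoverage.WeilGramLevel84

open Literature.NumberTheory.ComplexMultiplication
open Summit.HodgeConjecture.Ring2WeilCoverage.RealUnitNormHalfSystems (complexConj_eq_inv)
open Summit.HodgeConjecture.Ring2WeilCoverage.CyclotomicPrincipalObstruction (complexConj_xi)
variable {K : Type} [Field K] [NumberField K] {ζ : K}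

/-! ### §0 Level lemmas -/

omit [NumberField K] in
/-- **`Φ₈₄(ζ) = 0` written out** (`(x⁴² − 1)(x ^ 14 + 1)(x ^ 4 - x ^ 2 + 1)·Φ₈₄(x) = x⁸⁴ − 1`, `ζ⁴² ≠ 1`, `ζ²⁸ ≠ 1`, `ζ¹² ≠ 1`).
research route conditional on HC_CM; not a corollary; Q11.4-sentence-2 already refuted in dim ≥ 3. [folklore] -/
theorem cyc_eightyFour (hζ : IsPrimitiveRoot ζ 84) :
    ζ ^ 24 + ζ ^ 22 - ζ ^ 18 - ζ ^ 16 + ζ ^ 12 - ζ ^ 8 - ζ ^ 6 + ζ ^ 2 + 1 = 0 := by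
  have h84 : ζ ^ 84 = 1 := hζ.pow_eq_one
  have ha : ζ ^ 42 - 1 ≠ 0 := sub_ne_zero.mpr (hζ.pow_ne_one_of_pos_of_lt (by norm_num) (by norm_num))
  have hc0 : ζ ^ 28 ≠ 1 := hζ.pow_ne_one_of_pos_of_lt (by norm_num) (by norm_num)
  have hF0 : ζ ^ 14 + 1 ≠ 0 := by
    intro h
    apply hc0
    linear_combination (ζ ^ 14 - 1) * h
  have hc1 : ζ ^ 12 ≠ 1 := hζ.pow_ne_one_of_pos_of_lt (by norm_num) (by norm_num)
  have hF1 : ζ ^ 4 - ζ ^ 2 + 1 ≠ 0 := by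
    intro h
    apply hc1
    linear_combination (ζ ^ 8 + ζ ^ 6 - ζ ^ 2 - 1) * h
  have h : (ζ ^ 42 - 1) * (ζ ^ 14 + 1) * (ζ ^ 4 - ζ ^ 2 + 1) *
      (ζ ^ 24 + ζ ^ 22 - ζ ^ 18 - ζ ^ 16 + ζ ^ 12 - ζ ^ 8 - ζ ^ 6 + ζ ^ 2 + 1) = 0 := by
    linear_combination h84
  rcases mul_eq_zero.mp h with h' | h'
  · exact absurd h' (mul_ne_zero (mul_ne_zero ha hF0) hF1)
  · exact h'

omit [NumberField K] in
/-- `(ζ⁻¹)^a = ζ^b` when `a + b = 84`. [folklore] -/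
theorem inv_pow_eq_pow (hζ : IsPrimitiveRoot ζ 84) {a b : ℕ} (hab : a + b = 84) : ζ⁻¹ ^ a = ζ ^ b := by
  rw [inv_pow]
  apply inv_eq_of_mul_eq_one_right
  rw [← pow_add, hab, hζ.pow_eq_one]

/-- `θ = ζ + ζ⁻¹` is real. [folklore] -/
theorem complexConj_theta [IsCMField K] (hζ : IsPrimitiveRoot ζ 84) :
    IsCMField.complexConj K (ζ + ζ⁻¹) = ζ + ζ⁻¹ := by
  rw [map_add, map_inv₀, complexConj_eq_inv hζ, inv_inv, add_comm]

/-- The frame `xᵢ = θ^i` is real. [folklore] -/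
theorem complexConj_thetaFrame [IsCMField K] (hζ : IsPrimitiveRoot ζ 84) {m : ℕ} {x : Fin m → K}
    (hx : ∀ i, x i = (ζ + ζ⁻¹) ^ (i : ℕ)) (i : Fin m) : IsCMField.complexConj K (x i) = x i := by
  rw [hx i, map_pow, complexConj_theta hζ]

/-- `ξ = ζ^11/Φ′(ζ)` is skew (part 7, `g − 1 = 11`). [folklore] -/
theorem complexConj_xi_eightyFour [IsCMField K] (hζ : IsPrimitiveRoot ζ 84) :
    IsCMField.complexConj K (ζ ^ 11 * (aeval ζ (derivative (cyclotomic 84 ℚ)))⁻¹) =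
      -(ζ ^ 11 * (aeval ζ (derivative (cyclotomic 84 ℚ)))⁻¹) :=
  complexConj_xi hζ (k := 11) (by decide)

/-! ### §1 The skew generators -/

omit [NumberField K] in
/-- **`(ζ²¹)² = −1`**: `s = √−1 = ζ²¹ = i` generates `K_d = ℚ(√−1) ⊂ ℚ(ζ_84)`. [folklore] -/
theorem sq_sqrtNegOne (hζ : IsPrimitiveRoot ζ 84) : (ζ ^ 21) ^ 2 = -1 := by
  linear_combination (1 - ζ^2 + ζ^4 + ζ^14 - ζ^16 + ζ^18) * cyc_eightyFour hζ

/-- **`s = √−1 = ζ²¹ = i` is skew** (`s^ρ = −s`). [folklore] -/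
theorem complexConj_sqrtNegOne [IsCMField K] (hζ : IsPrimitiveRoot ζ 84) :
    IsCMField.complexConj K (ζ ^ 21) = -(ζ ^ 21) := by
  simp only [map_pow, complexConj_eq_inv hζ]
  rw [inv_pow_eq_pow hζ (show 21 + 63 = 84 by norm_num)]
  linear_combination (ζ^21 - ζ^23 + ζ^25 + ζ^35 - ζ^37 + ζ^39) * cyc_eightyFour hζ

omit [NumberField K] in
/-- **`(1 + 2ζ²⁸)² = −3`**: `s = √−3 = 1 + 2ζ²⁸ (ζ₃ = ζ²⁸)` generates `K_d = ℚ(√−3) ⊂ ℚ(ζ_84)`. [folklore] -/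
theorem sq_sqrtNegThree (hζ : IsPrimitiveRoot ζ 84) : (1 + 2 * ζ ^ 28) ^ 2 = -3 := by
  linear_combination (4 - 4 * ζ^2 + 4 * ζ^4 + 4 * ζ^14 - 4 * ζ^16 + 4 * ζ^18 + 4 * ζ^28 - 4 * ζ^30 + 4 * ζ^32) * cyc_eightyFour hζ

/-- **`s = √−3 = 1 + 2ζ²⁸ (ζ₃ = ζ²⁸)` is skew** (`s^ρ = −s`). [folklore] -/
theorem complexConj_sqrtNegThree [IsCMField K] (hζ : IsPrimitiveRoot ζ 84) :
    IsCMField.complexConj K (1 + 2 * ζ ^ 28) = -(1 + 2 * ζ ^ 28) := by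
  simp only [map_add, map_mul, map_pow, map_one, map_ofNat, complexConj_eq_inv hζ]
  rw [inv_pow_eq_pow hζ (show 28 + 56 = 84 by norm_num)]
  linear_combination (2 - 2 * ζ^2 + 2 * ζ^4 + 2 * ζ^14 - 2 * ζ^16 + 2 * ζ^18 + 2 * ζ^28 - 2 * ζ^30 + 2 * ζ^32) * cyc_eightyFour hζ

omit [NumberField K] in
/-- **`(1 + 2(ζ¹² + ζ²⁴ + ζ⁴⁸))² = −7`**: `s = √−7 = 1 + 2(ζ¹² + ζ²⁴ + ζ⁴⁸) (Gauss sum of ζ₇ = ζ¹²)` generates `K_d = ℚ(√−7) ⊂ ℚ(ζ_84)`. [folklore] -/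
theorem sq_sqrtNegSeven (hζ : IsPrimitiveRoot ζ 84) : (1 + 2 * (ζ ^ 12 + ζ ^ 24 + ζ ^ 48)) ^ 2 = -7 := by
  have h84 : ζ ^ 84 = 1 := hζ.pow_eq_one
  linear_combination (8 - 8 * ζ^2 + 8 * ζ^4 + 8 * ζ^12 + 8 * ζ^18 + 8 * ζ^24 + 8 * ζ^30 + 8 * ζ^36 + 8 * ζ^44 - 8 * ζ^46 + 8 * ζ^48) * cyc_eightyFour hζ +
    (4 * ζ^12) * h84

/-- **`s = √−7 = 1 + 2(ζ¹² + ζ²⁴ + ζ⁴⁸) (Gauss sum of ζ₇ = ζ¹²)` is skew** (`s^ρ = −s`). [folklore] -/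
theorem complexConj_sqrtNegSeven [IsCMField K] (hζ : IsPrimitiveRoot ζ 84) :
    IsCMField.complexConj K (1 + 2 * (ζ ^ 12 + ζ ^ 24 + ζ ^ 48)) = -(1 + 2 * (ζ ^ 12 + ζ ^ 24 + ζ ^ 48)) := by
  simp only [map_add, map_mul, map_pow, map_one, map_ofNat, complexConj_eq_inv hζ]
  rw [inv_pow_eq_pow hζ (show 12 + 72 = 84 by norm_num), inv_pow_eq_pow hζ (show 24 + 60 = 84 by norm_num), inv_pow_eq_pow hζ (show 48 + 36 = 84 by norm_num)]
  linear_combination (2 - 2 * ζ^2 + 2 * ζ^4 + 2 * ζ^12 + 2 * ζ^18 + 2 * ζ^24 + 2 * ζ^30 + 2 * ζ^36 + 2 * ζ^44 - 2 * ζ^46 + 2 * ζ^48) * cyc_eightyFour hζ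

omit [NumberField K] in
/-- **`(ζ²¹(1 + 2ζ²⁸)(1 + 2(ζ¹² + ζ²⁴ + ζ⁴⁸)))² = −21`**: `s = −√−21 = ζ²¹(1 + 2ζ²⁸)(1 + 2(ζ¹² + ζ²⁴ + ζ⁴⁸)) = i·√−3·√−7` generates `K_d = ℚ(√−21) ⊂ ℚ(ζ_84)`. [folklore] -/
theorem sq_sqrtNegTwentyOne (hζ : IsPrimitiveRoot ζ 84) : (ζ ^ 21 * (1 + 2 * ζ ^ 28) * (1 + 2 * (ζ ^ 12 + ζ ^ 24 + ζ ^ 48))) ^ 2 = -21 := by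
  have h84 : ζ ^ 84 = 1 := hζ.pow_eq_one
  linear_combination (21 + 11 * ζ^2 - 11 * ζ^4 + 40 * ζ^6 - 8 * ζ^8 + 40 * ζ^10 - 32 * ζ^12 + 57 * ζ^14 + 7 * ζ^16 + ζ^18 + 32 * ζ^20 + 32 * ζ^22 + 8 * ζ^24 + 32 * ζ^26 + 4 * ζ^28 + 36 * ζ^30 + 4 * ζ^32 + 32 * ζ^34 + 8 * ζ^36 + 32 * ζ^38 + 32 * ζ^40 - 20 * ζ^42 + 28 * ζ^44 + 36 * ζ^46 - 32 * ζ^48 + 40 * ζ^50 - 8 * ζ^52 + 40 * ζ^54 - 32 * ζ^56 + 32 * ζ^58) * cyc_eightyFour hζ +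
    (32 * ζ^2 + 8 * ζ^6 + 32 * ζ^10 + 4 * ζ^14 + 8 * ζ^18 + 32 * ζ^22 + 32 * ζ^26 + 8 * ζ^30 + 32 * ζ^34 + 32 * ζ^38 + 32 * ζ^46 + 32 * ζ^50 + 4 * ζ^54 + 32 * ζ^58 + 32 * ζ^62 + 32 * ζ^74 + 16 * ζ^82 + 32 * ζ^86 + 16 * ζ^110) * h84

/-- **`s = −√−21 = ζ²¹(1 + 2ζ²⁸)(1 + 2(ζ¹² + ζ²⁴ + ζ⁴⁸)) = i·√−3·√−7` is skew** (`s^ρ = −s`). [folklore] -/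
theorem complexConj_sqrtNegTwentyOne [IsCMField K] (hζ : IsPrimitiveRoot ζ 84) :
    IsCMField.complexConj K (ζ ^ 21 * (1 + 2 * ζ ^ 28) * (1 + 2 * (ζ ^ 12 + ζ ^ 24 + ζ ^ 48))) = -(ζ ^ 21 * (1 + 2 * ζ ^ 28) * (1 + 2 * (ζ ^ 12 + ζ ^ 24 + ζ ^ 48))) := by
  have h84 : ζ ^ 84 = 1 := hζ.pow_eq_one
  simp only [map_add, map_mul, map_pow, map_one, map_ofNat, complexConj_eq_inv hζ]
  rw [inv_pow_eq_pow hζ (show 12 + 72 = 84 by norm_num), inv_pow_eq_pow hζ (show 21 + 63 = 84 by norm_num), inv_pow_eq_pow hζ (show 24 + 60 = 84 by norm_num), inv_pow_eq_pow hζ (show 28 + 56 = 84 by norm_num), inv_pow_eq_pow hζ (show 48 + 36 = 84 by norm_num)]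
  linear_combination (4 * ζ^11 + 2 * ζ^15 + 2 * ζ^17 + 2 * ζ^19 + ζ^21 + 3 * ζ^23 + ζ^25 + 4 * ζ^27 + 2 * ζ^29 + 2 * ζ^31 + 4 * ζ^33 + ζ^35 + 3 * ζ^37 + ζ^39 + 2 * ζ^41 + 2 * ζ^43 + 2 * ζ^45 + 4 * ζ^49) * cyc_eightyFour hζ +
    (4 * ζ^11 + 4 * ζ^13 + 2 * ζ^15 + 4 * ζ^23 + 2 * ζ^35 + 2 * ζ^39 + 2 * ζ^51 + 4 * ζ^71 + 4 * ζ^95 + 4 * ζ^107) * h84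

/-! ### §2 `θ^12` on the frame and the trace recurrence -/

/-- **`θ^12` on the frame**: the minimal polynomial of `θ = ζ + ζ⁻¹` over `ℚ` (`Φ_84(x) = x^12ψ(x + x⁻¹)`), i.e.
`θ^12 = -1 + 16 * θ ^ 2 - 60 * θ ^ 4 + 78 * θ ^ 6 - 44 * θ ^ 8 + 11 * θ ^ 10`. research route conditional on HC_CM; not a corollary; Q11.4-sentence-2 already refuted in dim ≥ 3. [folklore] -/
theorem theta_pow_twelve (hζ : IsPrimitiveRoot ζ 84) :
    (ζ + ζ⁻¹) ^ 12 = -1 + 16 * (ζ + ζ⁻¹) ^ 2 - 60 * (ζ + ζ⁻¹) ^ 4 + 78 * (ζ + ζ⁻¹) ^ 6 - 44 * (ζ + ζ⁻¹) ^ 8 +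
      11 * (ζ + ζ⁻¹) ^ 10 := by
  have hζ0 : ζ ≠ 0 := hζ.ne_zero (by norm_num)
  have hΦ := cyc_eightyFour hζ
  have hθ : (ζ + ζ⁻¹) * ζ = ζ ^ 2 + 1 := by rw [add_mul, inv_mul_cancel₀ hζ0]; ring
  apply mul_right_cancel₀ (pow_ne_zero 12 hζ0)
  calc (ζ + ζ⁻¹) ^ 12 * ζ ^ 12 = ((ζ + ζ⁻¹) * ζ) ^ 12 := by ring
    _ = (ζ ^ 2 + 1) ^ 12 := by rw [hθ]
    _ = -ζ ^ 12 + 16 * (ζ ^ 2 + 1) ^ 2 * ζ ^ 10 - 60 * (ζ ^ 2 + 1) ^ 4 * ζ ^ 8 + 78 * (ζ ^ 2 + 1) ^ 6 * ζ ^ 6 -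
        44 * (ζ ^ 2 + 1) ^ 8 * ζ ^ 4 + 11 * (ζ ^ 2 + 1) ^ 10 * ζ ^ 2 := by
      linear_combination hΦ
    _ = -ζ ^ 12 + 16 * ((ζ + ζ⁻¹) * ζ) ^ 2 * ζ ^ 10 - 60 * ((ζ + ζ⁻¹) * ζ) ^ 4 * ζ ^ 8 +
        78 * ((ζ + ζ⁻¹) * ζ) ^ 6 * ζ ^ 6 - 44 * ((ζ + ζ⁻¹) * ζ) ^ 8 * ζ ^ 4 + 11 * ((ζ + ζ⁻¹) * ζ) ^ 10 * ζ ^ 2 := by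
      rw [hθ]
    _ = (-1 + 16 * (ζ + ζ⁻¹) ^ 2 - 60 * (ζ + ζ⁻¹) ^ 4 + 78 * (ζ + ζ⁻¹) ^ 6 - 44 * (ζ + ζ⁻¹) ^ 8 +
        11 * (ζ + ζ⁻¹) ^ 10) * ζ ^ 12 := by
      ring

/-- The trace recurrence at `θ^12`: `Tr(y·θ^12) = Σ eₖ·Tr(y·θ^{0+k})` from `θ^12 = Σ eₖ θ^k`. [folklore] -/
theorem trace_mul_theta_pow_twelve (hζ : IsPrimitiveRoot ζ 84) (y : K) :
    Algebra.trace ℚ K (y * (ζ + ζ⁻¹) ^ 12) =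
      (-1) * Algebra.trace ℚ K (y) + 16 * Algebra.trace ℚ K (y * (ζ + ζ⁻¹) ^ 2) +
      (-60) * Algebra.trace ℚ K (y * (ζ + ζ⁻¹) ^ 4) + 78 * Algebra.trace ℚ K (y * (ζ + ζ⁻¹) ^ 6) +
      (-44) * Algebra.trace ℚ K (y * (ζ + ζ⁻¹) ^ 8) + 11 * Algebra.trace ℚ K (y * (ζ + ζ⁻¹) ^ 10) := by
  have e : y * (ζ + ζ⁻¹) ^ 12 =
      (-1 : ℚ) • (y) + (16 : ℚ) • (y * (ζ + ζ⁻¹) ^ 2) + (-60 : ℚ) • (y * (ζ + ζ⁻¹) ^ 4) +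
      (78 : ℚ) • (y * (ζ + ζ⁻¹) ^ 6) + (-44 : ℚ) • (y * (ζ + ζ⁻¹) ^ 8) + (11 : ℚ) • (y * (ζ + ζ⁻¹) ^ 10) := by
    conv_lhs => rw [theta_pow_twelve hζ]
    simp only [Rat.smul_def]
    push_cast
    ring
  rw [e]
  simp only [map_add, map_smul, smul_eq_mul]

/-- The trace recurrence at `θ^13`: `Tr(y·θ^13) = Σ eₖ·Tr(y·θ^{1+k})` from `θ^12 = Σ eₖ θ^k`. [folklore] -/
theorem trace_mul_theta_pow_thirteen (hζ : IsPrimitiveRoot ζ 84) (y : K) :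
    Algebra.trace ℚ K (y * (ζ + ζ⁻¹) ^ 13) =
      (-1) * Algebra.trace ℚ K (y * (ζ + ζ⁻¹)) + 16 * Algebra.trace ℚ K (y * (ζ + ζ⁻¹) ^ 3) +
      (-60) * Algebra.trace ℚ K (y * (ζ + ζ⁻¹) ^ 5) + 78 * Algebra.trace ℚ K (y * (ζ + ζ⁻¹) ^ 7) +
      (-44) * Algebra.trace ℚ K (y * (ζ + ζ⁻¹) ^ 9) + 11 * Algebra.trace ℚ K (y * (ζ + ζ⁻¹) ^ 11) := by
  have e : y * (ζ + ζ⁻¹) ^ 13 =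
      (-1 : ℚ) • (y * (ζ + ζ⁻¹)) + (16 : ℚ) • (y * (ζ + ζ⁻¹) ^ 3) + (-60 : ℚ) • (y * (ζ + ζ⁻¹) ^ 5) +
      (78 : ℚ) • (y * (ζ + ζ⁻¹) ^ 7) + (-44 : ℚ) • (y * (ζ + ζ⁻¹) ^ 9) + (11 : ℚ) • (y * (ζ + ζ⁻¹) ^ 11) := by
    conv_lhs => rw [show y * (ζ + ζ⁻¹) ^ 13 = y * (ζ + ζ⁻¹) * (ζ + ζ⁻¹) ^ 12 by ring, theta_pow_twelve hζ]
    simp only [Rat.smul_def]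
    push_cast
    ring
  rw [e]
  simp only [map_add, map_smul, smul_eq_mul]

/-- The trace recurrence at `θ^14`: `Tr(y·θ^14) = Σ eₖ·Tr(y·θ^{2+k})` from `θ^12 = Σ eₖ θ^k`. [folklore] -/
theorem trace_mul_theta_pow_fourteen (hζ : IsPrimitiveRoot ζ 84) (y : K) :
    Algebra.trace ℚ K (y * (ζ + ζ⁻¹) ^ 14) =
      (-1) * Algebra.trace ℚ K (y * (ζ + ζ⁻¹) ^ 2) + 16 * Algebra.trace ℚ K (y * (ζ + ζ⁻¹) ^ 4) +
      (-60) * Algebra.trace ℚ K (y * (ζ + ζ⁻¹) ^ 6) + 78 * Algebra.trace ℚ K (y * (ζ + ζ⁻¹) ^ 8) +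
      (-44) * Algebra.trace ℚ K (y * (ζ + ζ⁻¹) ^ 10) + 11 * Algebra.trace ℚ K (y * (ζ + ζ⁻¹) ^ 12) := by
  have e : y * (ζ + ζ⁻¹) ^ 14 =
      (-1 : ℚ) • (y * (ζ + ζ⁻¹) ^ 2) + (16 : ℚ) • (y * (ζ + ζ⁻¹) ^ 4) + (-60 : ℚ) • (y * (ζ + ζ⁻¹) ^ 6) +
      (78 : ℚ) • (y * (ζ + ζ⁻¹) ^ 8) + (-44 : ℚ) • (y * (ζ + ζ⁻¹) ^ 10) + (11 : ℚ) • (y * (ζ + ζ⁻¹) ^ 12) := by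
    conv_lhs => rw [show y * (ζ + ζ⁻¹) ^ 14 = y * (ζ + ζ⁻¹) ^ 2 * (ζ + ζ⁻¹) ^ 12 by ring, theta_pow_twelve hζ]
    simp only [Rat.smul_def]
    push_cast
    ring
  rw [e]
  simp only [map_add, map_smul, smul_eq_mul]

/-- The trace recurrence at `θ^15`: `Tr(y·θ^15) = Σ eₖ·Tr(y·θ^{3+k})` from `θ^12 = Σ eₖ θ^k`. [folklore] -/
theorem trace_mul_theta_pow_fifteen (hζ : IsPrimitiveRoot ζ 84) (y : K) :
    Algebra.trace ℚ K (y * (ζ + ζ⁻¹) ^ 15) =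
      (-1) * Algebra.trace ℚ K (y * (ζ + ζ⁻¹) ^ 3) + 16 * Algebra.trace ℚ K (y * (ζ + ζ⁻¹) ^ 5) +
      (-60) * Algebra.trace ℚ K (y * (ζ + ζ⁻¹) ^ 7) + 78 * Algebra.trace ℚ K (y * (ζ + ζ⁻¹) ^ 9) +
      (-44) * Algebra.trace ℚ K (y * (ζ + ζ⁻¹) ^ 11) + 11 * Algebra.trace ℚ K (y * (ζ + ζ⁻¹) ^ 13) := by
  have e : y * (ζ + ζ⁻¹) ^ 15 =
      (-1 : ℚ) • (y * (ζ + ζ⁻¹) ^ 3) + (16 : ℚ) • (y * (ζ + ζ⁻¹) ^ 5) + (-60 : ℚ) • (y * (ζ + ζ⁻¹) ^ 7) +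
      (78 : ℚ) • (y * (ζ + ζ⁻¹) ^ 9) + (-44 : ℚ) • (y * (ζ + ζ⁻¹) ^ 11) + (11 : ℚ) • (y * (ζ + ζ⁻¹) ^ 13) := by
    conv_lhs => rw [show y * (ζ + ζ⁻¹) ^ 15 = y * (ζ + ζ⁻¹) ^ 3 * (ζ + ζ⁻¹) ^ 12 by ring, theta_pow_twelve hζ]
    simp only [Rat.smul_def]
    push_cast
    ring
  rw [e]
  simp only [map_add, map_smul, smul_eq_mul]

/-- The trace recurrence at `θ^16`: `Tr(y·θ^16) = Σ eₖ·Tr(y·θ^{4+k})` from `θ^12 = Σ eₖ θ^k`. [folklore] -/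
theorem trace_mul_theta_pow_sixteen (hζ : IsPrimitiveRoot ζ 84) (y : K) :
    Algebra.trace ℚ K (y * (ζ + ζ⁻¹) ^ 16) =
      (-1) * Algebra.trace ℚ K (y * (ζ + ζ⁻¹) ^ 4) + 16 * Algebra.trace ℚ K (y * (ζ + ζ⁻¹) ^ 6) +
      (-60) * Algebra.trace ℚ K (y * (ζ + ζ⁻¹) ^ 8) + 78 * Algebra.trace ℚ K (y * (ζ + ζ⁻¹) ^ 10) +
      (-44) * Algebra.trace ℚ K (y * (ζ + ζ⁻¹) ^ 12) + 11 * Algebra.trace ℚ K (y * (ζ + ζ⁻¹) ^ 14) := by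
  have e : y * (ζ + ζ⁻¹) ^ 16 =
      (-1 : ℚ) • (y * (ζ + ζ⁻¹) ^ 4) + (16 : ℚ) • (y * (ζ + ζ⁻¹) ^ 6) + (-60 : ℚ) • (y * (ζ + ζ⁻¹) ^ 8) +
      (78 : ℚ) • (y * (ζ + ζ⁻¹) ^ 10) + (-44 : ℚ) • (y * (ζ + ζ⁻¹) ^ 12) + (11 : ℚ) • (y * (ζ + ζ⁻¹) ^ 14) := by
    conv_lhs => rw [show y * (ζ + ζ⁻¹) ^ 16 = y * (ζ + ζ⁻¹) ^ 4 * (ζ + ζ⁻¹) ^ 12 by ring, theta_pow_twelve hζ]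
    simp only [Rat.smul_def]
    push_cast
    ring
  rw [e]
  simp only [map_add, map_smul, smul_eq_mul]

/-- The trace recurrence at `θ^17`: `Tr(y·θ^17) = Σ eₖ·Tr(y·θ^{5+k})` from `θ^12 = Σ eₖ θ^k`. [folklore] -/
theorem trace_mul_theta_pow_seventeen (hζ : IsPrimitiveRoot ζ 84) (y : K) :
    Algebra.trace ℚ K (y * (ζ + ζ⁻¹) ^ 17) =
      (-1) * Algebra.trace ℚ K (y * (ζ + ζ⁻¹) ^ 5) + 16 * Algebra.trace ℚ K (y * (ζ + ζ⁻¹) ^ 7) +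
      (-60) * Algebra.trace ℚ K (y * (ζ + ζ⁻¹) ^ 9) + 78 * Algebra.trace ℚ K (y * (ζ + ζ⁻¹) ^ 11) +
      (-44) * Algebra.trace ℚ K (y * (ζ + ζ⁻¹) ^ 13) + 11 * Algebra.trace ℚ K (y * (ζ + ζ⁻¹) ^ 15) := by
  have e : y * (ζ + ζ⁻¹) ^ 17 =
      (-1 : ℚ) • (y * (ζ + ζ⁻¹) ^ 5) + (16 : ℚ) • (y * (ζ + ζ⁻¹) ^ 7) + (-60 : ℚ) • (y * (ζ + ζ⁻¹) ^ 9) +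
      (78 : ℚ) • (y * (ζ + ζ⁻¹) ^ 11) + (-44 : ℚ) • (y * (ζ + ζ⁻¹) ^ 13) + (11 : ℚ) • (y * (ζ + ζ⁻¹) ^ 15) := by
    conv_lhs => rw [show y * (ζ + ζ⁻¹) ^ 17 = y * (ζ + ζ⁻¹) ^ 5 * (ζ + ζ⁻¹) ^ 12 by ring, theta_pow_twelve hζ]
    simp only [Rat.smul_def]
    push_cast
    ring
  rw [e]
  simp only [map_add, map_smul, smul_eq_mul]

/-- The trace recurrence at `θ^18`: `Tr(y·θ^18) = Σ eₖ·Tr(y·θ^{6+k})` from `θ^12 = Σ eₖ θ^k`. [folklore] -/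
theorem trace_mul_theta_pow_eighteen (hζ : IsPrimitiveRoot ζ 84) (y : K) :
    Algebra.trace ℚ K (y * (ζ + ζ⁻¹) ^ 18) =
      (-1) * Algebra.trace ℚ K (y * (ζ + ζ⁻¹) ^ 6) + 16 * Algebra.trace ℚ K (y * (ζ + ζ⁻¹) ^ 8) +
      (-60) * Algebra.trace ℚ K (y * (ζ + ζ⁻¹) ^ 10) + 78 * Algebra.trace ℚ K (y * (ζ + ζ⁻¹) ^ 12) +
      (-44) * Algebra.trace ℚ K (y * (ζ + ζ⁻¹) ^ 14) + 11 * Algebra.trace ℚ K (y * (ζ + ζ⁻¹) ^ 16) := by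
  have e : y * (ζ + ζ⁻¹) ^ 18 =
      (-1 : ℚ) • (y * (ζ + ζ⁻¹) ^ 6) + (16 : ℚ) • (y * (ζ + ζ⁻¹) ^ 8) + (-60 : ℚ) • (y * (ζ + ζ⁻¹) ^ 10) +
      (78 : ℚ) • (y * (ζ + ζ⁻¹) ^ 12) + (-44 : ℚ) • (y * (ζ + ζ⁻¹) ^ 14) + (11 : ℚ) • (y * (ζ + ζ⁻¹) ^ 16) := by
    conv_lhs => rw [show y * (ζ + ζ⁻¹) ^ 18 = y * (ζ + ζ⁻¹) ^ 6 * (ζ + ζ⁻¹) ^ 12 by ring, theta_pow_twelve hζ]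
    simp only [Rat.smul_def]
    push_cast
    ring
  rw [e]
  simp only [map_add, map_smul, smul_eq_mul]

/-- The trace recurrence at `θ^19`: `Tr(y·θ^19) = Σ eₖ·Tr(y·θ^{7+k})` from `θ^12 = Σ eₖ θ^k`. [folklore] -/
theorem trace_mul_theta_pow_nineteen (hζ : IsPrimitiveRoot ζ 84) (y : K) :
    Algebra.trace ℚ K (y * (ζ + ζ⁻¹) ^ 19) =
      (-1) * Algebra.trace ℚ K (y * (ζ + ζ⁻¹) ^ 7) + 16 * Algebra.trace ℚ K (y * (ζ + ζ⁻¹) ^ 9) +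
      (-60) * Algebra.trace ℚ K (y * (ζ + ζ⁻¹) ^ 11) + 78 * Algebra.trace ℚ K (y * (ζ + ζ⁻¹) ^ 13) +
      (-44) * Algebra.trace ℚ K (y * (ζ + ζ⁻¹) ^ 15) + 11 * Algebra.trace ℚ K (y * (ζ + ζ⁻¹) ^ 17) := by
  have e : y * (ζ + ζ⁻¹) ^ 19 =
      (-1 : ℚ) • (y * (ζ + ζ⁻¹) ^ 7) + (16 : ℚ) • (y * (ζ + ζ⁻¹) ^ 9) + (-60 : ℚ) • (y * (ζ + ζ⁻¹) ^ 11) +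
      (78 : ℚ) • (y * (ζ + ζ⁻¹) ^ 13) + (-44 : ℚ) • (y * (ζ + ζ⁻¹) ^ 15) + (11 : ℚ) • (y * (ζ + ζ⁻¹) ^ 17) := by
    conv_lhs => rw [show y * (ζ + ζ⁻¹) ^ 19 = y * (ζ + ζ⁻¹) ^ 7 * (ζ + ζ⁻¹) ^ 12 by ring, theta_pow_twelve hζ]
    simp only [Rat.smul_def]
    push_cast
    ring
  rw [e]
  simp only [map_add, map_smul, smul_eq_mul]

/-- The trace recurrence at `θ^20`: `Tr(y·θ^20) = Σ eₖ·Tr(y·θ^{8+k})` from `θ^12 = Σ eₖ θ^k`. [folklore] -/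
theorem trace_mul_theta_pow_twenty (hζ : IsPrimitiveRoot ζ 84) (y : K) :
    Algebra.trace ℚ K (y * (ζ + ζ⁻¹) ^ 20) =
      (-1) * Algebra.trace ℚ K (y * (ζ + ζ⁻¹) ^ 8) + 16 * Algebra.trace ℚ K (y * (ζ + ζ⁻¹) ^ 10) +
      (-60) * Algebra.trace ℚ K (y * (ζ + ζ⁻¹) ^ 12) + 78 * Algebra.trace ℚ K (y * (ζ + ζ⁻¹) ^ 14) +
      (-44) * Algebra.trace ℚ K (y * (ζ + ζ⁻¹) ^ 16) + 11 * Algebra.trace ℚ K (y * (ζ + ζ⁻¹) ^ 18) := by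
  have e : y * (ζ + ζ⁻¹) ^ 20 =
      (-1 : ℚ) • (y * (ζ + ζ⁻¹) ^ 8) + (16 : ℚ) • (y * (ζ + ζ⁻¹) ^ 10) + (-60 : ℚ) • (y * (ζ + ζ⁻¹) ^ 12) +
      (78 : ℚ) • (y * (ζ + ζ⁻¹) ^ 14) + (-44 : ℚ) • (y * (ζ + ζ⁻¹) ^ 16) + (11 : ℚ) • (y * (ζ + ζ⁻¹) ^ 18) := by
    conv_lhs => rw [show y * (ζ + ζ⁻¹) ^ 20 = y * (ζ + ζ⁻¹) ^ 8 * (ζ + ζ⁻¹) ^ 12 by ring, theta_pow_twelve hζ]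
    simp only [Rat.smul_def]
    push_cast
    ring
  rw [e]
  simp only [map_add, map_smul, smul_eq_mul]

/-- The trace recurrence at `θ^21`: `Tr(y·θ^21) = Σ eₖ·Tr(y·θ^{9+k})` from `θ^12 = Σ eₖ θ^k`. [folklore] -/
theorem trace_mul_theta_pow_twentyone (hζ : IsPrimitiveRoot ζ 84) (y : K) :
    Algebra.trace ℚ K (y * (ζ + ζ⁻¹) ^ 21) =
      (-1) * Algebra.trace ℚ K (y * (ζ + ζ⁻¹) ^ 9) + 16 * Algebra.trace ℚ K (y * (ζ + ζ⁻¹) ^ 11) +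
      (-60) * Algebra.trace ℚ K (y * (ζ + ζ⁻¹) ^ 13) + 78 * Algebra.trace ℚ K (y * (ζ + ζ⁻¹) ^ 15) +
      (-44) * Algebra.trace ℚ K (y * (ζ + ζ⁻¹) ^ 17) + 11 * Algebra.trace ℚ K (y * (ζ + ζ⁻¹) ^ 19) := by
  have e : y * (ζ + ζ⁻¹) ^ 21 =
      (-1 : ℚ) • (y * (ζ + ζ⁻¹) ^ 9) + (16 : ℚ) • (y * (ζ + ζ⁻¹) ^ 11) + (-60 : ℚ) • (y * (ζ + ζ⁻¹) ^ 13) +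
      (78 : ℚ) • (y * (ζ + ζ⁻¹) ^ 15) + (-44 : ℚ) • (y * (ζ + ζ⁻¹) ^ 17) + (11 : ℚ) • (y * (ζ + ζ⁻¹) ^ 19) := by
    conv_lhs => rw [show y * (ζ + ζ⁻¹) ^ 21 = y * (ζ + ζ⁻¹) ^ 9 * (ζ + ζ⁻¹) ^ 12 by ring, theta_pow_twelve hζ]
    simp only [Rat.smul_def]
    push_cast
    ring
  rw [e]
  simp only [map_add, map_smul, smul_eq_mul]

/-- The trace recurrence at `θ^22`: `Tr(y·θ^22) = Σ eₖ·Tr(y·θ^{10+k})` from `θ^12 = Σ eₖ θ^k`. [folklore] -/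
theorem trace_mul_theta_pow_twentytwo (hζ : IsPrimitiveRoot ζ 84) (y : K) :
    Algebra.trace ℚ K (y * (ζ + ζ⁻¹) ^ 22) =
      (-1) * Algebra.trace ℚ K (y * (ζ + ζ⁻¹) ^ 10) + 16 * Algebra.trace ℚ K (y * (ζ + ζ⁻¹) ^ 12) +
      (-60) * Algebra.trace ℚ K (y * (ζ + ζ⁻¹) ^ 14) + 78 * Algebra.trace ℚ K (y * (ζ + ζ⁻¹) ^ 16) +
      (-44) * Algebra.trace ℚ K (y * (ζ + ζ⁻¹) ^ 18) + 11 * Algebra.trace ℚ K (y * (ζ + ζ⁻¹) ^ 20) := by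
  have e : y * (ζ + ζ⁻¹) ^ 22 =
      (-1 : ℚ) • (y * (ζ + ζ⁻¹) ^ 10) + (16 : ℚ) • (y * (ζ + ζ⁻¹) ^ 12) + (-60 : ℚ) • (y * (ζ + ζ⁻¹) ^ 14) +
      (78 : ℚ) • (y * (ζ + ζ⁻¹) ^ 16) + (-44 : ℚ) • (y * (ζ + ζ⁻¹) ^ 18) + (11 : ℚ) • (y * (ζ + ζ⁻¹) ^ 20) := by
    conv_lhs => rw [show y * (ζ + ζ⁻¹) ^ 22 = y * (ζ + ζ⁻¹) ^ 10 * (ζ + ζ⁻¹) ^ 12 by ring, theta_pow_twelve hζ]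
    simp only [Rat.smul_def]
    push_cast
    ring
  rw [e]
  simp only [map_add, map_smul, smul_eq_mul]

end Summit.HodgeConjecture.Ring2WeilCoverage.WeilGramLevel84

end
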